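import Summits.HubbardSuperconductivity.HubbardSuperconductivity.Theorems.LevyLogBootstrapLevyTransportInfraredBound
import Summits.HubbardSuperconductivity.HubbardSuperconductivity.Theorems.LevyLogBootstrapBlock2InfDivXXZAutSymmetry
import Summits.HubbardSuperconductivity.HubbardSuperconductivity.Theorems.LevyLogBootstrapLevyTransportKernelPositivity
import HarnessLib

/-!
# Crux `LevyTransport` (stmt-HubbardSuperconductivity-15049, route `LevyLogBootstrap`), input (b):
# `M`-uniform nearest-neighbour transverse coherence of the half-filled XXZ torus

The log-bootstrap of `Cruxes/LevyTransport/Lines/birth.lean` (`stub_logBootstrap`) needs, besides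
the infrared bound (input (a), `LevyLogBootstrapLevyTransportInfraredBound.lean`), **(b) an
`L`-uniform lower bound on the nearest-neighbour transverse correlations** of the `S^z_tot = 0`
sector ground state `ψ` of `H_M(Δ) = xxzHamiltonian 1 (torusGraph 2 M) (-1) Δ` — the local
"block log-coherence" budget `U_κ` is built from it (the 2×2-block kernel at coarse distance one
dominates twice the nearest-neighbour kernel, all entries being positive). This file PROVES (b):

* `sectorGS_transverse_nnLowerBound` — for even `M ≥ 4`, `Δ ∈ [-1, 0]` and every normalised
  half-filled sector ground state `ψ`: `K_ψ(e₀) + K_ψ(e₁) ≥ 1/(2 - Δ)` and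
  `K_ψ(eᵢ) ≥ 1/(2(2 - Δ))` in both lattice directions, `K_ψ(z) = Re⟨ψ, S⁺_z S⁻_0 ψ⟩`;
* `sectorGS_transverse_nnLowerBound_uniform` — the `∀`-closed form with the constant `1/6`,
  uniform in `M` and in `Δ ∈ [-1, 0]` (registered on the item).

Proof: in Björnberg–Ueltschi's rotated frame `H' = anisotropicTorus 2 M 1 1 Δ 1` the tree proves the
polarised-state variational bound `¼ ≤ c⁰ + Δc¹ + c²` (`xyz_polarised_bound`), the planar symmetry
`c⁰ = c²` (`xyzBondCorr_zero_eq_two_of_J₁_eq_one`) and B–U's Lemma A.1 `|c¹| ≤ c²`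
(`xyz_abs_bondCorr_one_le_two`, `|Δ| ≤ 1`), whence `(2 - Δ)c⁰ ≥ ¼`; and the dictionary of the
infrared-bound file (`transverseKernel_eq_two_mul_xyzGroundCorr`, translation invariance and evenness
of the kernel) identifies `c⁰ = (K_ψ(e₀) + K_ψ(e₁))/4` (`xyzBondCorr_zero_eq_quarter_nnCoherence`);
the two directions agree by the coordinate-swap covariance of sector ground states
(`sectorGS_transverseCorr_compPerm`).

Sources: J. E. Björnberg, D. Ueltschi, arXiv:2204.12896, eq. (3.10), Lemma A.1, Prop. 2.4;
K. Kubo, T. Kishi, Phys. Rev. Lett. 61 (1988) 2585 (variational principle with the constant state);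
T. Kennedy, E. H. Lieb, B. S. Shastry, J. Stat. Phys. 53 (1988) 1019. No definition is introduced;
sorry-free.
-/

noncomputable section

set_option linter.dupNamespace false

namespace Summit.HubbardSuperconductivity.HubbardSuperconductivity.Theorems.LevyLogBootstrap

open scoped BigOperators Matrix ComplexOrder ComplexConjugate
open Matrix Finset Complex
open Literature.MathematicalPhysics.QuantumLattice Literature.Probability.LatticeModels

/-! ### Input (b) of `stub_logBootstrap`: `M`-uniform lower bound on the nearest-neighbour transverse coherence -/

section LocalCoherence

variable (M : ℕ) [NeZero M]

/-- **The first-component bond correlation of the rotated frame is a quarter of the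
nearest-neighbour transverse coherence**: `xyzBondCorr 0 M 1 1 Δ = (K_ψ(e₀) + K_ψ(e₁))/4`,
`K_ψ(z) = Re⟨ψ, S⁺_z S⁻_0 ψ⟩`, for every normalised half-filled sector ground state `ψ` of
`H_M(Δ)` (even `M ≥ 4`, `Δ ≤ 0`): `G⁰(x, x+eᵢ) = K_ψ(-eᵢ)/2 = K_ψ(eᵢ)/2`
(`transverseKernel_eq_two_mul_xyzGroundCorr`, translation invariance and evenness of the kernel).
[cite: BjornbergUeltschi2022, eq. (3.8)] -/
theorem xyzBondCorr_zero_eq_quarter_nnCoherence (hM : Even M) (h4 : 4 ≤ M) {Δ : ℝ} (hΔ : Δ ≤ 0)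
    (ψ : TensorIndex (TorusSite 2 M) 2 → ℂ)
    (hψ : ψ ∈ @spinZSector (TorusSite 2 M) _ _ 1 0) (hnorm : star ψ ⬝ᵥ ψ = 1)
    (heig : Matrix.mulVec (xxzHamiltonian 1 (torusGraph 2 M) (-1) Δ) ψ =
      ((lowestEnergyInSector 1 (xxzHamiltonian 1 (torusGraph 2 M) (-1) Δ) 0 : ℝ) : ℂ) • ψ) :
    xyzBondCorr (d := 2) 0 M 1 1 Δ =
      ((star ψ ⬝ᵥ (onSite (Pi.single 0 1 : TorusSite 2 M) (spinRaise 1) * onSite 0 (spinLower 1)) *ᵥ ψ).re +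
        (star ψ ⬝ᵥ (onSite (Pi.single 1 1 : TorusSite 2 M) (spinRaise 1) * onSite 0 (spinLower 1)) *ᵥ ψ).re) / 4 := by
  set K : TorusSite 2 M → ℝ := fun z =>
    (star ψ ⬝ᵥ (onSite z (spinRaise 1) * onSite 0 (spinLower 1)) *ᵥ ψ).re with hK
  have hG : ∀ (x : TorusSite 2 M) (i : Fin 2),
      xyzGroundCorr 0 M 1 1 Δ x (x + Pi.single i 1) = K (Pi.single i 1) / 2 := by
    intro x i
    have h := transverseKernel_eq_two_mul_xyzGroundCorr M hM h4 hΔ ψ hnorm heig x (x + Pi.single i 1)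
    rw [gs_transverseKernel_eq_sub M hM Δ ψ hψ hnorm heig x (x + Pi.single i 1), sub_add_cancel_left,
      gs_transverseKernel_neg M hM Δ ψ hψ hnorm heig (Pi.single i 1)] at h
    simp only [hK]
    linarith
  have hM2 : (0 : ℝ) < (M : ℝ) ^ 2 := by
    have : (0 : ℝ) < (M : ℝ) := by exact_mod_cast Nat.pos_of_ne_zero (NeZero.ne M)
    positivity
  rw [xyzBondCorr_of_neZero]
  simp_rw [hG, Fin.sum_univ_two]
  rw [sum_const, card_univ, card_torusSite, nsmul_eq_mul]
  push_cast
  field_simp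
  simp only [hK]
  ring

/-- **The nearest-neighbour transverse coherence is the same in both lattice directions**
(coordinate swap, `sectorGS_transverseCorr_compPerm`): `K_ψ(e₀) = K_ψ(e₁)`. [folklore] -/
theorem nnCoherence_dir_eq (Δ : ℝ) (ψ : TensorIndex (TorusSite 2 M) 2 → ℂ)
    (hψ : ψ ∈ @spinZSector (TorusSite 2 M) _ _ 1 0)
    (heig : Matrix.mulVec (xxzHamiltonian 1 (torusGraph 2 M) (-1) Δ) ψ =
      ((lowestEnergyInSector 1 (xxzHamiltonian 1 (torusGraph 2 M) (-1) Δ) 0 : ℝ) : ℂ) • ψ) :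
    (star ψ ⬝ᵥ (onSite (Pi.single 0 1 : TorusSite 2 M) (spinRaise 1) * onSite 0 (spinLower 1)) *ᵥ ψ).re =
      (star ψ ⬝ᵥ (onSite (Pi.single 1 1 : TorusSite 2 M) (spinRaise 1) * onSite 0 (spinLower 1)) *ᵥ ψ).re := by
  have h := sectorGS_transverseCorr_compPerm M Δ 0 (Equiv.swap 0 1) ψ hψ heig (Pi.single 0 1) 0
  have h1 : ((Pi.single 0 1 : TorusSite 2 M) ∘ (Equiv.swap (0 : Fin 2) 1)) = Pi.single 1 1 := by
    funext i
    fin_cases i <;> simp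
  have h0 : ((0 : TorusSite 2 M) ∘ (Equiv.swap (0 : Fin 2) 1)) = 0 := by
    funext i; rfl
  rw [h1, h0] at h
  rw [h]

/-- **Input (b) of the log-bootstrap (crux `LevyTransport`, stmt-HubbardSuperconductivity-15049):
`M`-uniform nearest-neighbour transverse coherence of the half-filled XXZ torus.** For even
`M ≥ 4`, `Δ ∈ [-1, 0]` and every normalised `S^z_tot = 0` sector ground state `ψ` of
`xxzHamiltonian 1 (torusGraph 2 M) (-1) Δ`:
`K_ψ(e₀) + K_ψ(e₁) ≥ 1/(2 - Δ)` and `K_ψ(eᵢ) ≥ 1/(2(2 - Δ)) ≥ 1/6`, `K_ψ(z) = Re⟨ψ, S⁺_z S⁻_0 ψ⟩`.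
Energetic, no reflection positivity beyond the tree's orbit inequalities: the polarised-state
variational bound `¼ ≤ c⁰ + Δc¹ + c²` (`xyz_polarised_bound`), `c⁰ = c²` at `J₁ = 1`
(`xyzBondCorr_zero_eq_two_of_J₁_eq_one`) and `|c¹| ≤ c²` (`xyz_abs_bondCorr_one_le_two`, B–U Lemma
A.1) give `(2 - Δ)c⁰ ≥ ¼`, and `c⁰ = (K_ψ(e₀) + K_ψ(e₁))/4`.
[cite: BjornbergUeltschi2022, eq. (3.10) and Lemma A.1] [cite: KuboKishi1988] -/
theorem sectorGS_transverse_nnLowerBound (hM : Even M) (h4 : 4 ≤ M) {Δ : ℝ} (hΔ1 : -1 ≤ Δ)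
    (hΔ0 : Δ ≤ 0) (ψ : TensorIndex (TorusSite 2 M) 2 → ℂ)
    (hψ : ψ ∈ @spinZSector (TorusSite 2 M) _ _ 1 0) (hnorm : star ψ ⬝ᵥ ψ = 1)
    (heig : Matrix.mulVec (xxzHamiltonian 1 (torusGraph 2 M) (-1) Δ) ψ =
      ((lowestEnergyInSector 1 (xxzHamiltonian 1 (torusGraph 2 M) (-1) Δ) 0 : ℝ) : ℂ) • ψ) :
    1 / (2 - Δ) ≤
      (star ψ ⬝ᵥ (onSite (Pi.single 0 1 : TorusSite 2 M) (spinRaise 1) * onSite 0 (spinLower 1)) *ᵥ ψ).re +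
        (star ψ ⬝ᵥ (onSite (Pi.single 1 1 : TorusSite 2 M) (spinRaise 1) * onSite 0 (spinLower 1)) *ᵥ ψ).re ∧
    ∀ i : Fin 2, 1 / (2 * (2 - Δ)) ≤
      (star ψ ⬝ᵥ (onSite (Pi.single i 1 : TorusSite 2 M) (spinRaise 1) * onSite 0 (spinLower 1)) *ᵥ ψ).re := by
  set K0 : ℝ := (star ψ ⬝ᵥ (onSite (Pi.single 0 1 : TorusSite 2 M) (spinRaise 1) *
    onSite 0 (spinLower 1)) *ᵥ ψ).re with hK0
  set K1 : ℝ := (star ψ ⬝ᵥ (onSite (Pi.single 1 1 : TorusSite 2 M) (spinRaise 1) *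
    onSite 0 (spinLower 1)) *ᵥ ψ).re with hK1
  set c0 : ℝ := xyzBondCorr (d := 2) 0 M 1 1 Δ with hc0
  set c1 : ℝ := xyzBondCorr (d := 2) 1 M 1 1 Δ with hc1
  set c2 : ℝ := xyzBondCorr (d := 2) 2 M 1 1 Δ with hc2
  have hV : (((1 : ℕ) : ℝ) / 2) ^ 2 ≤ c0 + Δ * c1 + 1 * c2 :=
    xyz_polarised_bound M 1 1 Δ (by omega) (by norm_num)
  have h02 : c0 = c2 := xyzBondCorr_zero_eq_two_of_J₁_eq_one M 1 Δ
  have h12 : |c1| ≤ c2 := xyz_abs_bondCorr_one_le_two M 1 1 Δ (by omega) (by linarith) (by linarith)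
  have hc0K : c0 = (K0 + K1) / 4 :=
    xyzBondCorr_zero_eq_quarter_nnCoherence M hM h4 hΔ0 ψ hψ hnorm heig
  have hkey : 1 / 4 ≤ (2 - Δ) * c0 := by
    have t : Δ * c1 ≤ -Δ * c2 := by
      have := neg_abs_le c1
      have := le_abs_self c1
      nlinarith [abs_nonneg c1]
    norm_num at hV
    nlinarith
  have hpos : (0 : ℝ) < 2 - Δ := by linarith
  have hsum : 1 / (2 - Δ) ≤ K0 + K1 := by
    rw [div_le_iff₀ hpos]
    nlinarith
  have hdir : K0 = K1 := nnCoherence_dir_eq M Δ ψ hψ heig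
  refine ⟨hsum, fun i => ?_⟩
  have hhalf : 1 / (2 * (2 - Δ)) ≤ K0 := by
    rw [div_le_iff₀ (by positivity)]
    rw [div_le_iff₀ hpos, ← hdir] at hsum
    linarith
  fin_cases i
  · exact hhalf
  · simpa [← hK1, ← hdir] using hhalf

/-- **Input (b) on the route's interval**, `∀`-closed and with a constant uniform in `M` and in
`Δ ∈ [-1, 0]`: every normalised half-filled sector ground state of `H_M(Δ)` (even `M ≥ 4`) has
nearest-neighbour transverse coherence `Re⟨ψ, S⁺_{eᵢ} S⁻_0 ψ⟩ ≥ 1/6` in both lattice directions.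
[cite: BjornbergUeltschi2022, eq. (3.10) and Lemma A.1] -/
theorem sectorGS_transverse_nnLowerBound_uniform :
    ∀ (M : ℕ) [NeZero M], Even M → 4 ≤ M → ∀ Δ ∈ Set.Icc (-1 : ℝ) 0,
      ∀ (ψ : TensorIndex (TorusSite 2 M) 2 → ℂ),
      ψ ∈ @spinZSector (TorusSite 2 M) _ _ 1 0 → star ψ ⬝ᵥ ψ = 1 →
      Matrix.mulVec (xxzHamiltonian 1 (torusGraph 2 M) (-1) Δ) ψ =
        ((lowestEnergyInSector 1 (xxzHamiltonian 1 (torusGraph 2 M) (-1) Δ) 0 : ℝ) : ℂ) • ψ →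
      ∀ i : Fin 2, (1 / 6 : ℝ) ≤
        (star ψ ⬝ᵥ (onSite (Pi.single i 1 : TorusSite 2 M) (spinRaise 1) * onSite 0 (spinLower 1)) *ᵥ ψ).re := by
  intro M _ hM h4 Δ hΔ ψ hψ hnorm heig i
  obtain ⟨-, h⟩ := sectorGS_transverse_nnLowerBound M hM h4 hΔ.1 hΔ.2 ψ hψ hnorm heig
  refine le_trans ?_ (h i)
  rw [div_le_div_iff₀ (by norm_num) (by linarith [hΔ.2])]
  linarith [hΔ.1]

end LocalCoherence

/-! ### Input (b) in the coarse form consumed by `logBootstrap_explicit_of_inputs` -/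

section Coarse

variable (M : ℕ) {m : ℕ} [NeZero M]

/-- **The 2×2-block kernel at coarse distance one dominates the nearest-neighbour coherence**:
`k₂(Eᵢ) ≥ K_ψ(eᵢ)` — among the `16` POSITIVE terms (`LevyFloor.transverseKernel_pos_all`) of the
block sum `k₂(Eᵢ) = Σ_{x'∈B_{Eᵢ}, y'∈B_0} Re⟨ψ, S⁺_{x'} S⁻_{y'} ψ⟩` is the boundary pair
`x' = 2eᵢ`, `y' = eᵢ`, whose term is `K_ψ(eᵢ)` by translation invariance. Hence, by
`sectorGS_transverse_nnLowerBound`, `k₂(Eᵢ) ≥ 1/(2(2 - Δ))` for `Δ ∈ [-1, 0]` (even `M = 2m ≥ 4`) —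
the hypothesis `hlow` of `local_logCoherence_le_of_lower` on `D = {E₀, E₁}`. [folklore] -/
theorem coarseKernel_nn_lower (hM : M = 2 * m) (hEven : Even M) (h4 : 4 ≤ M) {Δ : ℝ}
    (hΔ1 : -1 ≤ Δ) (hΔ0 : Δ ≤ 0) (ψ : TensorIndex (TorusSite 2 M) 2 → ℂ)
    (hψ : ψ ∈ @spinZSector (TorusSite 2 M) _ _ 1 0) (hnorm : star ψ ⬝ᵥ ψ = 1)
    (heig : Matrix.mulVec (xxzHamiltonian 1 (torusGraph 2 M) (-1) Δ) ψ =
      ((lowestEnergyInSector 1 (xxzHamiltonian 1 (torusGraph 2 M) (-1) Δ) 0 : ℝ) : ℂ) • ψ)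
    (i : Fin 2) :
    1 / (2 * (2 - Δ)) ≤ ∑ x' : TorusSite 2 M, ∑ y' : TorusSite 2 M,
      if (∀ j : Fin 2, (x' j).val / 2 = ((Pi.single i 1 : TorusSite 2 m) j).val) ∧
          (∀ j : Fin 2, (y' j).val / 2 = 0) then
        (star ψ ⬝ᵥ Matrix.mulVec (onSite x' (spinRaise 1) * onSite y' (spinLower 1)) ψ).re
      else 0 := by
  classical
  have hm2 : 2 ≤ m := by omega
  -- the boundary pair `a = 2eᵢ ∈ B_{Eᵢ}`, `b = eᵢ ∈ B_0`
  set a : TorusSite 2 M := Pi.single i (((2 : ℕ) : ZMod M)) with ha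
  set b : TorusSite 2 M := Pi.single i (((1 : ℕ) : ZMod M)) with hb
  have hval2 : (((2 : ℕ) : ZMod M)).val = 2 := by
    rw [ZMod.val_natCast, Nat.mod_eq_of_lt (by omega)]
  have hval1 : (((1 : ℕ) : ZMod M)).val = 1 := by
    rw [ZMod.val_natCast, Nat.mod_eq_of_lt (by omega)]
  have hval1m : ((1 : ZMod m)).val = 1 := by
    rw [ZMod.val_one_eq_one_mod, Nat.mod_eq_of_lt (by omega)]
  have haB : ∀ j : Fin 2, (a j).val / 2 = ((Pi.single i 1 : TorusSite 2 m) j).val := by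
    intro j
    by_cases hj : j = i
    · subst hj
      rw [ha, Pi.single_eq_same, Pi.single_eq_same, hval2, hval1m]
    · rw [ha, Pi.single_eq_of_ne hj, Pi.single_eq_of_ne hj, ZMod.val_zero, ZMod.val_zero]
  have hbB : ∀ j : Fin 2, (b j).val / 2 = 0 := by
    intro j
    by_cases hj : j = i
    · subst hj
      rw [hb, Pi.single_eq_same, hval1]
    · rw [hb, Pi.single_eq_of_ne hj, ZMod.val_zero]
  have hab : a - b = Pi.single i 1 := by
    rw [ha, hb, ← Pi.single_sub]
    congr 1
    have h21 : (((2 : ℕ) : ZMod M)) - (((1 : ℕ) : ZMod M)) = (((2 - 1 : ℕ) : ℕ) : ZMod M) := by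
      rw [Nat.cast_sub (by norm_num)]
    rw [h21]
    norm_num
  -- all terms are nonnegative
  set f : TorusSite 2 M → TorusSite 2 M → ℝ := fun x' y' =>
    if (∀ j : Fin 2, (x' j).val / 2 = ((Pi.single i 1 : TorusSite 2 m) j).val) ∧
        (∀ j : Fin 2, (y' j).val / 2 = 0) then
      (star ψ ⬝ᵥ Matrix.mulVec (onSite x' (spinRaise 1) * onSite y' (spinLower 1)) ψ).re
    else 0 with hf
  have hnn : ∀ x' y' : TorusSite 2 M, 0 ≤ f x' y' := fun x' y' => by
    simp only [hf]
    split_ifs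
    · exact (LevyFloor.transverseKernel_pos_all M hEven h4 Δ ψ hψ hnorm heig x' y').le
    · exact le_rfl
  have hfab : f a b = (star ψ ⬝ᵥ Matrix.mulVec (onSite (Pi.single i 1 : TorusSite 2 M) (spinRaise 1) *
      onSite 0 (spinLower 1)) ψ).re := by
    simp only [hf]
    rw [if_pos ⟨haB, hbB⟩, gs_transverseKernel_eq_sub M hEven Δ ψ hψ hnorm heig a b, hab]
  obtain ⟨-, hdir⟩ := sectorGS_transverse_nnLowerBound M hEven h4 hΔ1 hΔ0 ψ hψ hnorm heig
  calc 1 / (2 * (2 - Δ))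
      ≤ f a b := by rw [hfab]; exact hdir i
    _ ≤ ∑ y' : TorusSite 2 M, f a y' :=
        Finset.single_le_sum (f := fun y' => f a y') (fun y' _ => hnn a y') (Finset.mem_univ b)
    _ ≤ ∑ x' : TorusSite 2 M, ∑ y' : TorusSite 2 M, f x' y' :=
        Finset.single_le_sum (f := fun x' => ∑ y' : TorusSite 2 M, f x' y')
          (fun x' _ => Finset.sum_nonneg fun y' _ => hnn x' y') (Finset.mem_univ a)

/-- **Input (b), coarse and uniform**: for even `M = 2m ≥ 4`, `Δ ∈ [-1, 0]` and every normalised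
half-filled sector ground state `ψ`, the 2×2-block kernel at the two coarse unit displacements is at
least `1/6`: `k₂(E₀), k₂(E₁) ≥ 1/6` — feed `ℓ = 1/6`, `D = {E₀, E₁}` to
`local_logCoherence_le_of_lower` (then `Σ_{Z∈D}(log k₂(0) - log k₂(Z)) ≤ 2 log 48`). [folklore] -/
theorem coarseKernel_nn_lower_uniform (hM : M = 2 * m) (hEven : Even M) (h4 : 4 ≤ M) {Δ : ℝ}
    (hΔ : Δ ∈ Set.Icc (-1 : ℝ) 0) (ψ : TensorIndex (TorusSite 2 M) 2 → ℂ)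
    (hψ : ψ ∈ @spinZSector (TorusSite 2 M) _ _ 1 0) (hnorm : star ψ ⬝ᵥ ψ = 1)
    (heig : Matrix.mulVec (xxzHamiltonian 1 (torusGraph 2 M) (-1) Δ) ψ =
      ((lowestEnergyInSector 1 (xxzHamiltonian 1 (torusGraph 2 M) (-1) Δ) 0 : ℝ) : ℂ) • ψ) :
    ∀ Z ∈ ({Pi.single 0 1, Pi.single 1 1} : Finset (TorusSite 2 m)),
      (1 / 6 : ℝ) ≤ ∑ x' : TorusSite 2 M, ∑ y' : TorusSite 2 M,
        if (∀ j : Fin 2, (x' j).val / 2 = (Z j).val) ∧ (∀ j : Fin 2, (y' j).val / 2 = 0) then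
          (star ψ ⬝ᵥ Matrix.mulVec (onSite x' (spinRaise 1) * onSite y' (spinLower 1)) ψ).re
        else 0 := by
  have hsix : ∀ i : Fin 2, (1 / 6 : ℝ) ≤ ∑ x' : TorusSite 2 M, ∑ y' : TorusSite 2 M,
      if (∀ j : Fin 2, (x' j).val / 2 = ((Pi.single i 1 : TorusSite 2 m) j).val) ∧
          (∀ j : Fin 2, (y' j).val / 2 = 0) then
        (star ψ ⬝ᵥ Matrix.mulVec (onSite x' (spinRaise 1) * onSite y' (spinLower 1)) ψ).re
      else 0 := fun i => by
    refine le_trans ?_ (coarseKernel_nn_lower M hM hEven h4 hΔ.1 hΔ.2 ψ hψ hnorm heig i)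
    rw [div_le_div_iff₀ (by norm_num) (by linarith [hΔ.2])]
    linarith [hΔ.1]
  intro Z hZ
  rcases Finset.mem_insert.1 hZ with rfl | hZ
  · exact hsix 0
  · rw [Finset.mem_singleton] at hZ
    subst hZ
    exact hsix 1

/-- The same on the displacement set written as `Finset.univ.image (fun i => Pi.single i 1)` — the
literal set `D` of hypothesis (b) of `logBootstrap_explicit_of_inputs`. [folklore] -/
theorem coarseKernel_nn_lower_image (hM : M = 2 * m) (hEven : Even M) (h4 : 4 ≤ M) {Δ : ℝ}
    (hΔ : Δ ∈ Set.Icc (-1 : ℝ) 0) (ψ : TensorIndex (TorusSite 2 M) 2 → ℂ)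
    (hψ : ψ ∈ @spinZSector (TorusSite 2 M) _ _ 1 0) (hnorm : star ψ ⬝ᵥ ψ = 1)
    (heig : Matrix.mulVec (xxzHamiltonian 1 (torusGraph 2 M) (-1) Δ) ψ =
      ((lowestEnergyInSector 1 (xxzHamiltonian 1 (torusGraph 2 M) (-1) Δ) 0 : ℝ) : ℂ) • ψ) :
    ∀ Z ∈ Finset.univ.image (fun i : Fin 2 => (Pi.single i 1 : TorusSite 2 m)),
      1 / (2 * (2 - Δ)) ≤ ∑ x' : TorusSite 2 M, ∑ y' : TorusSite 2 M,
        if (∀ j : Fin 2, (x' j).val / 2 = (Z j).val) ∧ (∀ j : Fin 2, (y' j).val / 2 = 0) then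
          (star ψ ⬝ᵥ Matrix.mulVec (onSite x' (spinRaise 1) * onSite y' (spinLower 1)) ψ).re
        else 0 := by
  intro Z hZ
  obtain ⟨i, -, rfl⟩ := Finset.mem_image.1 hZ
  exact coarseKernel_nn_lower M hM hEven h4 hΔ.1 hΔ.2 ψ hψ hnorm heig i

end Coarse

end Summit.HubbardSuperconductivity.HubbardSuperconductivity.Theorems.LevyLogBootstrap
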